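import Summits.QuantumFields.BalabanUV.T4Continuum.Support.SubstrateComplexBlockAvgInv

/-!
# SUBSTRATE — W-24c-α = LIBRARY L-E18b PART 2α, module 2∕2 (typer (π3), `HOME/CLAIMS.log` l.23334): THE COMPLEX (0.4) AVERAGING TOWER ON
# TWO-SIDED FINE DATA — `Setup.Averaging.iter`'s recursion on PAIRS, level `k` read through `siteIdx` as `iterRS (K − k)` (the formula of
# `towerDataOf`, p220490 l.329) —, its REAL TIE with `towerDataOf P ι (fun _ => blockAvg ℰ) U` (both sides) on levelwise-small fields, HOLOMORPHY
# at the real point, and the TOWER CHART COORDINATE of the fine-field slice `towerCoord … z := logChartT P (towerDataOf …) (towerSlice … z).1`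
# (W-24a BY NAME) with W-22′'s letters (1) «`= 0` at `z = 0`» and (2′)-at-0 «holomorphic at `z = 0`», `SU(n)` discharges modulo the field's
# levelwise smallness, and the identification of W-22′'s chart family with the two towers on the log window

Cell `pub-balaban`, SUBSTRATE cell, seat `b2b-balaban-substrate-p1` (gen 7).  Numbered by the substrate typer (π3) (`HOME/CLAIMS.log` l.23334; OFFER
l.23182, STAGED l.23292): W-24c = L-E18b PART 2 is split into 2α (this pair of modules: the two-sided TOWER and its chart coordinate at the real point,
p1 g7), 2β (`SubstrateComplexAvgTowerDisc`: the depth disc, p4 g5) and PART 3 = W-24d (the `FineFieldChart` inhabitant, p2 g6).  Summits-side under the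
LEAN PLACEMENT RULE; [folklore] algebra over W-24b PART 1 (p2 g6 `SubstrateComplexBlockAvg` p240835: `holRS`, `loopHolRS`, `axialRS`, `corrRS`, `avgRS`,
`holRS_hom_eq`, `corrRS_hom_eq_of_small`, `avgRS_hom_eq_of_small`, `analyticAt_holRS`, `analyticAt_avgRS`, `sliceR`∕`sliceS`, `sliceR_mul_sliceS`,
`fundamentalRep_expMeanLogSU_E`), W-24a (p4 g5 `SubstrateExpChartLog` p240014: `logChartT`, `logChartT_self_of_unitary`, `expChartT_logChartT_of_unitary`,
`analyticAt_logChartT_comp`, `norm_centre_window_lt_one`), the tree's (0.4) vocabulary (`BlockAveraging.loopHol ∕ corr ∕ blockAvg ∕ Small`,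
`T4Continuum.walk ∕ walkEnd ∕ wordRev ∕ holAt_walk_wordRev`, `ExpMeanLog.eml ∕ eml_inv_mul ∕ eml_mul_inv ∕ analyticAt_eml`) and p220490's `towerDataOf` ∕
`expChart(Inv)` BY NAME; nothing restated, nothing printed asserted, no citation tags, no `Prop`-valued fact minted.

HONEST FRAMING: rung (B)+1 of the FINITE-VOLUME T⁴ programme — NOT infinite volume, NOT a mass gap, NOT Clay; spine PROVED 0∕9; a
CONSTRUCTION (the complexification of the averaging TOWER of record) + its analyticity at the real point BY NAME — NO estimate of any NE row;
nothing of [Balaban1985Averaging] ∕ [Balaban1987RG1] (0.4)–(0.9) asserted beyond what `BlockAveraging*` PROVES; NE5 NOT PRINTED ∕ NOT PROVED.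
NOT IN W-24c-α: the depth disc (letter (3) of `FineFieldChart` and holomorphy on the WHOLE unit disc — a continuity estimate keeping every level's
loop variables in the window: W-24c-β), the real tie for real `z ≠ 0` (letter (4)), the reach (5), and the `FineFieldChart` inhabitant (W-24d); the
`1∕3`-smallness at `z ≠ 0` and the log window at `z ≠ 0` are DISPLAYED letters here.  HONEST DEPENDENCY (cell line, verbatim): continuum YM on T⁴ ⇐
BetaPertH ∧ nine spine estimates (0/9 proved); BetaPertH ⇐ (D1) ∧ (D4) ∧ CAP+tail; G-an2-4 gates asym, D1 and NE2/3/4.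

WHAT.
* §2 THE ITERATION `stepRS`, **`iterRS k`**; **`iterRS_hom_eq`** (levelwise `Small ℰ (M^j U) c`, `j < k`, `M := blockAvg ℰ`, `ℰ.δ ≤ 1∕3`, `hdist`, `hE` ⊢
  `iterRS k (ι∘U, ι∘U⁻¹) = (ι ∘ M^k U, ι ∘ (M^k U)⁻¹)`); `iterRS_mul` (the inverse invariant along the iteration); **`analyticAt_iterRS`** (along analytic
  two-sided families whose base point has 1-small loop variables, both orientations, at every level `< k`); **`analyticAt_iterRS_hom`** (real point).
* §3 THE TOWER: `readT` (`transV` without `ι`; `transV_eq_readT` rfl), **`towerRS P RS : TowerData P o × TowerData P o`**, **`towerRS_hom_eq_fst`**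
  (`= towerDataOf P ι (fun _ => blockAvg ℰ) U`) ∕ `towerRS_hom_eq_snd` (`= expChartInvT P (towerDataOf …) 0`), `analyticAt_towerRS_apply` ∕ `_fst`.
* §4 `towerSlice ι U H z := towerRS P (sliceR ι U H z, sliceS ι U H z)`, **`towerCoord ℰ ι U H z`**, `towerSlice_zero(_fst)`; LETTER (1) **`towerCoord_zero`**;
  LETTER (2′)-at-0 **`analyticAt_towerCoord_zero`**; `sliceS_mul_sliceR`, `towerSlice_snd_mul_fst` (the two towers of the slice are entrywise mutual
  inverses under DISPLAYED `1∕3`-smallness at `z`), **`expChartT_towerCoord`** ∕ **`expChartInvT_towerCoord`** (on the log window W-22′'s chart family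
  `ComplexBackgroundFamily.ofChart (towerDataOf …) _ (towerCoord …)` reads EXACTLY the two towers); `expMeanLogSU_δ_le_third`, **`towerCoord_zero_SU`** ∕
  **`analyticAt_towerCoord_zero_SU`** (`ℰ := expMeanLogSU`, `ι := fundamentalRep n`; only `∀ j < P.K, ∀ c, Small expMeanLogSU (M^j U) c` left).
0 sorry; axioms ⊆ {propext, Classical.choice, Quot.sound}.
-/

noncomputable section

open scoped Matrix.Norms.L2Operator BigOperators

namespace Summit.QuantumFields.BalabanUV.T4Continuum.SubstrateComplexAvgTower

open Literature.MathematicalPhysics.QuantumFieldTheory.Balaban1983to89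
open Literature.MathematicalPhysics.QuantumFieldTheory.Balaban1983to89.T4Continuum (Letter LStep holAt walk walkEnd wordRev loopWord
  axialAvg_eq_holAt_walk holAt_walk_wordRev)
open Literature.MathematicalPhysics.QuantumFieldTheory.Balaban1983to89.BlockAveraging (Idx off loopHol corr avgFun blockAvg Small)
open Literature.MathematicalPhysics.QuantumFieldTheory.Balaban1983to89.ExpMeanLog (eml analyticAt_eml eml_inv_mul eml_mul_inv expMeanLogSU)
open Literature.MathematicalPhysics.QuantumFieldTheory.Balaban1983to89.B5Prop11Plancherel (Tor fine)
open Literature.MathematicalPhysics.QuantumFieldTheory.Balaban1983to89.B5G183RateUnitTower (lev)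
open Literature.MathematicalPhysics.QuantumLattice (fundamentalRep fundamentalRep_mem_unitaryGroup)
open Summit.QuantumFields.BalabanUV.T4Continuum.SubstrateBackgroundTransporters (transV siteIdx unitMod)
open Summit.QuantumFields.BalabanUV.T4Continuum.SubstrateTransporterSpecies (TowerData towerDataOf isUnit_det_of_mem_unitaryGroup)
open Summit.QuantumFields.BalabanUV.T4Continuum.SubstrateTransporterSpeciesHolo (expChartT expChartInvT)
open Summit.QuantumFields.BalabanUV.T4Continuum.SubstrateExpChartLog (logChartT logChartT_self_of_unitary analyticAt_logChartT_comp
  norm_centre_window_lt_one isUnit_det_of_unitary)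
open Summit.QuantumFields.BalabanUV.T4Continuum.SubstrateComplexBlockAvg
open Summit.QuantumFields.BalabanUV.T4Continuum.SubstrateComplexBlockAvgInv

variable {P : Params} {j : ℕ}

/-! ## §2 The iteration on pairs -/

section Iter

variable {𝔸 : Type*} [NormedRing 𝔸] [NormedAlgebra ℂ 𝔸]

/-- [folklore] **ONE TWO-SIDED STEP**: `(R, S) ↦ (avgRS R S, avgSR R S)`. -/
def stepRS (RS : (PBond P j → 𝔸) × (PBond P j → 𝔸)) : (PBond P (j + 1) → 𝔸) × (PBond P (j + 1) → 𝔸) :=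
  (avgRS RS.1 RS.2, avgSR RS.1 RS.2)

/-- [folklore] **THE COMPLEX (0.4) AVERAGING ITERATION ON TWO-SIDED DATA** — the recursion of `Setup.Averaging.iter` on pairs:
`iterRS 0 = id`, `iterRS (k+1) = stepRS ∘ iterRS k`. -/
def iterRS : (k : ℕ) → (PBond P 0 → 𝔸) × (PBond P 0 → 𝔸) → (PBond P k → 𝔸) × (PBond P k → 𝔸)
  | 0 => id
  | k + 1 => stepRS ∘ iterRS k

/-- [folklore] `iterRS 0 = id` (`rfl`). -/
@[simp] theorem iterRS_zero (RS : (PBond P 0 → 𝔸) × (PBond P 0 → 𝔸)) : iterRS 0 RS = RS := rfl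

/-- [folklore] `iterRS (k+1) = stepRS ∘ iterRS k` (`rfl`). -/
theorem iterRS_succ (k : ℕ) (RS : (PBond P 0 → 𝔸) × (PBond P 0 → 𝔸)) : iterRS (k + 1) RS = stepRS (iterRS k RS) := rfl

variable [CompleteSpace 𝔸] {G : Type*} [GaugeGroup G]

/-- [folklore] **REAL TIE OF THE ITERATION**: on a fine field `U` that is `ℰ`-small at every coarse bond of every level `< k`
(`Small ℰ (M^j U) c`, `M := blockAvg ℰ`), with `ℰ.δ ≤ 1∕3`, `hdist`, `hE` as in §1, the `k`-fold complex iteration of `(ι∘U, ι∘U⁻¹)` IS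
`(ι ∘ M^k U, ι ∘ (M^k U)⁻¹)` — `Setup.Averaging.iter (fun _ => blockAvg ℰ) k U` read through `ι`, both sides. -/
theorem iterRS_hom_eq (ℰ : LoopAverage G) (hδ : ℰ.δ ≤ 1 / 3) (ι : G →* 𝔸) (hdist : ∀ g : G, ‖ι g - 1‖ = dist1 g)
    (hE : ∀ {m : ℕ} (W : Fin (m + 1) → G), (∀ i, dist1 (W i) < ℰ.δ) → ι (ℰ.E W) = eml fun i => ι (W i)) (U : GaugeField P 0 G) :
    ∀ k : ℕ, (∀ j < k, ∀ c, Small ℰ (Averaging.iter (fun _ => blockAvg ℰ) j U) c) →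
      iterRS k (fun b => ι (U b), fun b => ι (U b)⁻¹) =
        (fun c => ι (Averaging.iter (fun _ => blockAvg ℰ) k U c), fun c => ι (Averaging.iter (fun _ => blockAvg ℰ) k U c)⁻¹)
  | 0, _ => rfl
  | k + 1, hsmall => by
    rw [iterRS_succ, iterRS_hom_eq ℰ hδ ι hdist hE U k fun j hj => hsmall j (Nat.lt_succ_of_lt hj), stepRS]
    refine Prod.ext (funext fun c => ?_) (funext fun c => ?_)
    · exact avgRS_hom_eq_of_small ℰ ι hE (hsmall k (Nat.lt_succ_self k) c)
    · exact avgSR_hom_eq_of_small ℰ hδ ι hdist hE (hsmall k (Nat.lt_succ_self k) c)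

omit [CompleteSpace 𝔸] in
/-- [folklore] **THE INVERSE INVARIANT ALONG THE ITERATION**: bondwise mutually inverse fine data whose iterated loop variables are `1∕3`-small
at every level `< k` stay bondwise mutually inverse at level `k` (§1 `avgSR_mul_avgRS` ∕ `avgRS_mul_avgSR`, induction). -/
theorem iterRS_mul [CompleteSpace 𝔸] {R S : PBond P 0 → 𝔸} (hSR : ∀ b, S b * R b = 1) (hRS : ∀ b, R b * S b = 1) :
    ∀ k : ℕ, (∀ j < k, ∀ c i, ‖loopHolRS (iterRS j (R, S)).1 (iterRS j (R, S)).2 c i - 1‖ ≤ 1 / 3) →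
      (∀ c, (iterRS k (R, S)).2 c * (iterRS k (R, S)).1 c = 1) ∧ (∀ c, (iterRS k (R, S)).1 c * (iterRS k (R, S)).2 c = 1)
  | 0, _ => ⟨hSR, hRS⟩
  | k + 1, hsmall => by
    obtain ⟨h1, h2⟩ := iterRS_mul hSR hRS k fun j hj => hsmall j (Nat.lt_succ_of_lt hj)
    exact ⟨fun c => avgSR_mul_avgRS h1 h2 (hsmall k (Nat.lt_succ_self k) c), fun c => avgRS_mul_avgSR h1 h2 (hsmall k (Nat.lt_succ_self k) c)⟩

variable {E : Type*} [NormedAddCommGroup E] [NormedSpace ℂ E]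

omit [CompleteSpace 𝔸] in
/-- [folklore] The two components of `stepRS` along a family (`rfl` views). -/
theorem stepRS_apply (RS : (PBond P j → 𝔸) × (PBond P j → 𝔸)) :
    (stepRS RS).1 = avgRS RS.1 RS.2 ∧ (stepRS RS).2 = avgSR RS.1 RS.2 := ⟨rfl, rfl⟩

/-- [folklore] **THE ITERATION IS HOLOMORPHIC** along an analytic two-sided family of fine data, at every parameter `x` whose iterated
data have 1-small loop variables in BOTH orientations at every coarse bond of every level `< k` (induction on `k`; §1 + W-24b §3). -/
theorem analyticAt_iterRS {R S : E → PBond P 0 → 𝔸} {x : E} (hR : ∀ b, AnalyticAt ℂ (fun y => R y b) x)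
    (hS : ∀ b, AnalyticAt ℂ (fun y => S y b) x) :
    ∀ k : ℕ, (∀ j < k, ∀ c i, ‖loopHolRS (iterRS j (R x, S x)).1 (iterRS j (R x, S x)).2 c i - 1‖ < 1 ∧
        ‖loopHolSR (iterRS j (R x, S x)).1 (iterRS j (R x, S x)).2 c i - 1‖ < 1) →
      (∀ c, AnalyticAt ℂ (fun y => (iterRS k (R y, S y)).1 c) x) ∧ (∀ c, AnalyticAt ℂ (fun y => (iterRS k (R y, S y)).2 c) x)
  | 0, _ => ⟨hR, hS⟩
  | k + 1, hsmall => by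
    obtain ⟨h1, h2⟩ := analyticAt_iterRS hR hS k fun j hj => hsmall j (Nat.lt_succ_of_lt hj)
    refine ⟨fun c => ?_, fun c => ?_⟩
    · exact analyticAt_avgRS (R := fun y => (iterRS k (R y, S y)).1) (S := fun y => (iterRS k (R y, S y)).2) h1 h2 c
        fun i => (hsmall k (Nat.lt_succ_self k) c i).1
    · exact analyticAt_avgSR (R := fun y => (iterRS k (R y, S y)).1) (S := fun y => (iterRS k (R y, S y)).2) h1 h2 c
        fun i => (hsmall k (Nat.lt_succ_self k) c i).2

/-- [folklore] **… AT THE REAL POINT**: if the family passes at `x` through `(ι∘U, ι∘U⁻¹)` for a fine field `U` that is `ℰ`-small at every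
level `< k` (`ℰ.δ ≤ 1∕3`, `hdist`, `hE`), the smallness hypotheses of `analyticAt_iterRS` hold there (real tie + `dist1_inv`). -/
theorem analyticAt_iterRS_hom (ℰ : LoopAverage G) (hδ : ℰ.δ ≤ 1 / 3) (ι : G →* 𝔸) (hdist : ∀ g : G, ‖ι g - 1‖ = dist1 g)
    (hE : ∀ {m : ℕ} (W : Fin (m + 1) → G), (∀ i, dist1 (W i) < ℰ.δ) → ι (ℰ.E W) = eml fun i => ι (W i)) (U : GaugeField P 0 G)
    {R S : E → PBond P 0 → 𝔸} {x : E} (hR : ∀ b, AnalyticAt ℂ (fun y => R y b) x) (hS : ∀ b, AnalyticAt ℂ (fun y => S y b) x)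
    (hRx : R x = fun b => ι (U b)) (hSx : S x = fun b => ι (U b)⁻¹) (k : ℕ)
    (hsmall : ∀ j < k, ∀ c, Small ℰ (Averaging.iter (fun _ => blockAvg ℰ) j U) c) :
    (∀ c, AnalyticAt ℂ (fun y => (iterRS k (R y, S y)).1 c) x) ∧ (∀ c, AnalyticAt ℂ (fun y => (iterRS k (R y, S y)).2 c) x) := by
  refine analyticAt_iterRS hR hS k fun j hj c i => ?_
  rw [hRx, hSx, iterRS_hom_eq ℰ hδ ι hdist hE U j fun j' hj' => hsmall j' (hj'.trans hj), loopHolRS_hom_eq, loopHolSR_hom_eq, hdist,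
    hdist, GaugeGroup.dist1_inv]
  have h := (hsmall j hj c i).trans_le (hδ.trans (by norm_num : (1 : ℝ) / 3 ≤ 1))
  exact ⟨h, h⟩

end Iter

/-! ## §3 The tower -/

section Tower

variable (P) {o : Type*} [Fintype o] [DecidableEq o]

/-- [folklore] **BOND DATA READ IN A CHART** (`transV` without the representation): `readT e F ν i := F ⟨e.symm i.1, ν⟩`. -/
def readT {N : Fin P.d → ℕ} (e : Site P j ≃ Tor N) (F : PBond P j → Matrix o o ℂ) : Fin P.d → (Tor N × Fin P.d → Matrix o o ℂ) :=
  fun ν i => F ⟨e.symm i.1, ν⟩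

omit [Fintype o] [DecidableEq o] in
/-- [folklore] `readT` unfolds (`rfl`). -/
@[simp] theorem readT_apply {N : Fin P.d → ℕ} (e : Site P j ≃ Tor N) (F : PBond P j → Matrix o o ℂ) (ν : Fin P.d) (i : Tor N × Fin P.d) :
    readT P e F ν i = F ⟨e.symm i.1, ν⟩ := rfl

/-- [folklore] `transV e ι U = readT e (ι ∘ U)` (`rfl`). -/
theorem transV_eq_readT {N : Fin P.d → ℕ} (e : Site P j ≃ Tor N) {G : Type*} [GaugeGroup G] (ι : G →* Matrix o o ℂ)
    (U : GaugeField P j G) : transV e ι U = readT P e fun b => ι (U b) := rfl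

/-- [folklore] **THE COMPLEX AVERAGING TOWER ON TWO-SIDED FINE DATA**: level `k ≤ K` reads the `(K − k)`-fold iterate `iterRS (K − k)`
through the tower chart `siteIdx` — the formula of `towerDataOf` (p220490 l.329) with `Averaging.iter` replaced by `iterRS`, both sides. -/
def towerRS (RS : (PBond P 0 → Matrix o o ℂ) × (PBond P 0 → Matrix o o ℂ)) : TowerData P o × TowerData P o :=
  (fun k => readT P (siteIdx P (j := P.K - k) (k := k) (by have := k.2; omega)) (iterRS (P.K - k) RS).1,
   fun k => readT P (siteIdx P (j := P.K - k) (k := k) (by have := k.2; omega)) (iterRS (P.K - k) RS).2)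

variable {P} {G : Type*} [GaugeGroup G]

/-- [folklore] **REAL TIE OF THE TOWER, `R`-side**: on a fine field small at every level `< K` the complex tower of `(ι∘U, ι∘U⁻¹)` IS the
averaging tower of record `towerDataOf P ι (fun _ => blockAvg ℰ) U`. -/
theorem towerRS_hom_eq_fst (ℰ : LoopAverage G) (hδ : ℰ.δ ≤ 1 / 3) (ι : G →* Matrix o o ℂ) (hdist : ∀ g : G, ‖ι g - 1‖ = dist1 g)
    (hE : ∀ {m : ℕ} (W : Fin (m + 1) → G), (∀ i, dist1 (W i) < ℰ.δ) → ι (ℰ.E W) = eml fun i => ι (W i)) (U : GaugeField P 0 G)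
    (hsmall : ∀ j < P.K, ∀ c, Small ℰ (Averaging.iter (fun _ => blockAvg ℰ) j U) c) :
    (towerRS P (fun b => ι (U b), fun b => ι (U b)⁻¹)).1 = towerDataOf P ι (fun _ => blockAvg ℰ) U := by
  funext k
  show readT P _ (iterRS (P.K - k) _).1 = transV _ ι _
  rw [iterRS_hom_eq ℰ hδ ι hdist hE U (P.K - k) fun j hj => hsmall j (by omega), transV_eq_readT]

/-- [folklore] **REAL TIE OF THE TOWER, `S`-side**: the inverse-side tower IS the inverse-side tower of record
`expChartInvT P (towerDataOf …) 0 = fun k ν i => (towerDataOf … k ν i)⁻¹` (as matrices `(ι g)⁻¹ = ι g⁻¹`). -/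
theorem towerRS_hom_eq_snd (ℰ : LoopAverage G) (hδ : ℰ.δ ≤ 1 / 3) (ι : G →* Matrix o o ℂ) (hdist : ∀ g : G, ‖ι g - 1‖ = dist1 g)
    (hE : ∀ {m : ℕ} (W : Fin (m + 1) → G), (∀ i, dist1 (W i) < ℰ.δ) → ι (ℰ.E W) = eml fun i => ι (W i)) (U : GaugeField P 0 G)
    (hsmall : ∀ j < P.K, ∀ c, Small ℰ (Averaging.iter (fun _ => blockAvg ℰ) j U) c) :
    (towerRS P (fun b => ι (U b), fun b => ι (U b)⁻¹)).2 = expChartInvT P (towerDataOf P ι (fun _ => blockAvg ℰ) U) 0 := by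
  funext k ν i
  have hk := iterRS_hom_eq ℰ hδ ι hdist hE U (P.K - k) fun j hj => hsmall j (by omega)
  show readT P _ (iterRS (P.K - k) _).2 ν i =
    SubstrateTransporterSpecies.expChartInv (towerDataOf P ι (fun _ => blockAvg ℰ) U k) ((0 : TowerData P o) k) ν i
  rw [hk, Pi.zero_apply, SubstrateTransporterSpecies.expChartInv_zero, readT_apply]
  symm
  exact Matrix.inv_eq_left_inv (by rw [towerDataOf, SubstrateBackgroundTransporters.transV_apply, ← map_mul, inv_mul_cancel, map_one])

variable {E : Type*} [NormedAddCommGroup E] [NormedSpace ℂ E]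

/-- [folklore] **THE TOWER IS HOLOMORPHIC AT THE REAL POINT, entrywise**: along an analytic two-sided family of fine data passing at `x`
through `(ι∘U, ι∘U⁻¹)`, `U` small at every level `< K`, every entry of both towers is analytic at `x`. -/
theorem analyticAt_towerRS_apply (ℰ : LoopAverage G) (hδ : ℰ.δ ≤ 1 / 3) (ι : G →* Matrix o o ℂ) (hdist : ∀ g : G, ‖ι g - 1‖ = dist1 g)
    (hE : ∀ {m : ℕ} (W : Fin (m + 1) → G), (∀ i, dist1 (W i) < ℰ.δ) → ι (ℰ.E W) = eml fun i => ι (W i)) (U : GaugeField P 0 G)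
    {R S : E → PBond P 0 → Matrix o o ℂ} {x : E} (hR : ∀ b, AnalyticAt ℂ (fun y => R y b) x) (hS : ∀ b, AnalyticAt ℂ (fun y => S y b) x)
    (hRx : R x = fun b => ι (U b)) (hSx : S x = fun b => ι (U b)⁻¹)
    (hsmall : ∀ j < P.K, ∀ c, Small ℰ (Averaging.iter (fun _ => blockAvg ℰ) j U) c) (k : Fin (P.K + 1)) (ν : Fin P.d)
    (i : Tor (fine (lev P.L k) (unitMod P)) × Fin P.d) :
    AnalyticAt ℂ (fun y => (towerRS P (R y, S y)).1 k ν i) x ∧ AnalyticAt ℂ (fun y => (towerRS P (R y, S y)).2 k ν i) x := by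
  obtain ⟨h1, h2⟩ := analyticAt_iterRS_hom ℰ hδ ι hdist hE U hR hS hRx hSx (P.K - k) fun j hj => hsmall j (by omega)
  exact ⟨h1 _, h2 _⟩

/-- [folklore] **THE `R`-TOWER IS HOLOMORPHIC AT THE REAL POINT as a map into `TowerData P o`** (the shape W-24a's
`analyticAt_logChartT_comp` consumes). -/
theorem analyticAt_towerRS_fst (ℰ : LoopAverage G) (hδ : ℰ.δ ≤ 1 / 3) (ι : G →* Matrix o o ℂ) (hdist : ∀ g : G, ‖ι g - 1‖ = dist1 g)
    (hE : ∀ {m : ℕ} (W : Fin (m + 1) → G), (∀ i, dist1 (W i) < ℰ.δ) → ι (ℰ.E W) = eml fun i => ι (W i)) (U : GaugeField P 0 G)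
    {R S : E → PBond P 0 → Matrix o o ℂ} {x : E} (hR : ∀ b, AnalyticAt ℂ (fun y => R y b) x) (hS : ∀ b, AnalyticAt ℂ (fun y => S y b) x)
    (hRx : R x = fun b => ι (U b)) (hSx : S x = fun b => ι (U b)⁻¹)
    (hsmall : ∀ j < P.K, ∀ c, Small ℰ (Averaging.iter (fun _ => blockAvg ℰ) j U) c) :
    AnalyticAt ℂ (fun y => (towerRS P (R y, S y)).1) x :=
  analyticAt_pi_iff.2 fun k => analyticAt_pi_iff.2 fun ν => analyticAt_pi_iff.2 fun i =>
    (analyticAt_towerRS_apply ℰ hδ ι hdist hE U hR hS hRx hSx hsmall k ν i).1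

end Tower

/-! ## §4 The tower chart coordinate of the fine-field slice: letters (1) and (2′)-at-0 -/

section Slice

variable (P) {o : Type*} [Fintype o] [DecidableEq o] {G : Type*} [GaugeGroup G]

/-- [folklore] **THE COMPLEX AVERAGING TOWERS OF THE FINE-FIELD SLICE** `z ↦ (exp(zH)·ι U, ι U⁻¹·exp(−zH))` (W-24b `sliceR`∕`sliceS`). -/
def towerSlice (ι : G →* Matrix o o ℂ) (U : GaugeField P 0 G) (H : PBond P 0 → Matrix o o ℂ) (z : ℂ) : TowerData P o × TowerData P o :=
  towerRS P (sliceR ι U H z, sliceS ι U H z)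

/-- [folklore] **THE TOWER CHART COORDINATE OF THE SLICE** relative to the averaging tower of record of `U` (W-24a `logChartT`): by intent
W-22′'s `FineFieldChart.slice k u` at centre `U` and direction `H` (before the depth rescaling of `H`). -/
def towerCoord (ℰ : LoopAverage G) (ι : G →* Matrix o o ℂ) (U : GaugeField P 0 G) (H : PBond P 0 → Matrix o o ℂ) (z : ℂ) : TowerData P o :=
  logChartT P (towerDataOf P ι (fun _ => blockAvg ℰ) U) (towerSlice P ι U H z).1

variable {P}

/-- [folklore] At `z = 0` the slice towers are the complex towers of the real data (`sliceR_zero`, `sliceS_zero`). -/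
theorem towerSlice_zero (ι : G →* Matrix o o ℂ) (U : GaugeField P 0 G) (H : PBond P 0 → Matrix o o ℂ) :
    towerSlice P ι U H 0 = towerRS P (fun b => ι (U b), fun b => ι (U b)⁻¹) := by
  rw [towerSlice, sliceR_zero, sliceS_zero]

/-- [folklore] **AT `z = 0` THE `R`-TOWER OF THE SLICE IS THE AVERAGING TOWER OF RECORD** (levelwise-small `U`). -/
theorem towerSlice_zero_fst (ℰ : LoopAverage G) (hδ : ℰ.δ ≤ 1 / 3) (ι : G →* Matrix o o ℂ) (hdist : ∀ g : G, ‖ι g - 1‖ = dist1 g)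
    (hE : ∀ {m : ℕ} (W : Fin (m + 1) → G), (∀ i, dist1 (W i) < ℰ.δ) → ι (ℰ.E W) = eml fun i => ι (W i)) (U : GaugeField P 0 G)
    (H : PBond P 0 → Matrix o o ℂ) (hsmall : ∀ j < P.K, ∀ c, Small ℰ (Averaging.iter (fun _ => blockAvg ℰ) j U) c) :
    (towerSlice P ι U H 0).1 = towerDataOf P ι (fun _ => blockAvg ℰ) U := by
  rw [towerSlice_zero]; exact towerRS_hom_eq_fst ℰ hδ ι hdist hE U hsmall

/-- [folklore] **LETTER (1) FOR THE TOWER**: the chart coordinate vanishes at `z = 0` (`ι` unitary-valued, `U` levelwise small; W-24a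
`logChartT_self_of_unitary` at the unitary tower of record). -/
theorem towerCoord_zero (ℰ : LoopAverage G) (hδ : ℰ.δ ≤ 1 / 3) (ι : G →* Matrix o o ℂ) (hι : ∀ g, ι g ∈ Matrix.unitaryGroup o ℂ)
    (hdist : ∀ g : G, ‖ι g - 1‖ = dist1 g)
    (hE : ∀ {m : ℕ} (W : Fin (m + 1) → G), (∀ i, dist1 (W i) < ℰ.δ) → ι (ℰ.E W) = eml fun i => ι (W i)) (U : GaugeField P 0 G)
    (H : PBond P 0 → Matrix o o ℂ) (hsmall : ∀ j < P.K, ∀ c, Small ℰ (Averaging.iter (fun _ => blockAvg ℰ) j U) c) :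
    towerCoord P ℰ ι U H 0 = 0 := by
  rw [towerCoord, towerSlice_zero_fst ℰ hδ ι hdist hE U H hsmall]
  exact logChartT_self_of_unitary P fun k ν i => by
    rw [towerDataOf, SubstrateBackgroundTransporters.transV_apply]; exact hι _

/-- [folklore] **LETTER (2′) AT `z = 0` FOR THE TOWER**: the chart coordinate `z ↦ towerCoord P ℰ ι U H z` is HOLOMORPHIC AT `z = 0` as a map
`ℂ → TowerData P o` (`ℰ.δ ≤ 1∕3`, `ι` unitary-valued realising `dist1`, `hE`, `U` levelwise small): W-24a `analyticAt_logChartT_comp` ∘ §3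
`analyticAt_towerRS_fst` along W-24b's entire slice, the log window at `0` being the centre (`norm_centre_window_lt_one`). -/
theorem analyticAt_towerCoord_zero (ℰ : LoopAverage G) (hδ : ℰ.δ ≤ 1 / 3) (ι : G →* Matrix o o ℂ)
    (hι : ∀ g, ι g ∈ Matrix.unitaryGroup o ℂ) (hdist : ∀ g : G, ‖ι g - 1‖ = dist1 g)
    (hE : ∀ {m : ℕ} (W : Fin (m + 1) → G), (∀ i, dist1 (W i) < ℰ.δ) → ι (ℰ.E W) = eml fun i => ι (W i)) (U : GaugeField P 0 G)
    (H : PBond P 0 → Matrix o o ℂ) (hsmall : ∀ j < P.K, ∀ c, Small ℰ (Averaging.iter (fun _ => blockAvg ℰ) j U) c) :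
    AnalyticAt ℂ (towerCoord P ℰ ι U H) 0 := by
  have hT : AnalyticAt ℂ (fun z => (towerSlice P ι U H z).1) 0 :=
    analyticAt_towerRS_fst ℰ hδ ι hdist hE U (fun b => analyticAt_sliceR ι U H 0 b) (fun b => analyticAt_sliceS ι U H 0 b)
      (sliceR_zero ι U H) (sliceS_zero ι U H) hsmall
  refine analyticAt_logChartT_comp P hT fun k ν i => ?_
  rw [towerSlice_zero_fst ℰ hδ ι hdist hE U H hsmall]
  exact norm_centre_window_lt_one P (isUnit_det_of_unitary P fun k ν i => by
    rw [towerDataOf, SubstrateBackgroundTransporters.transV_apply]; exact hι _) k ν i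

/-- [folklore] **THE INVERSE SIDE OF THE SLICE IS A LEFT INVERSE TOO**: `sliceS z b * sliceR z b = 1` (companion of W-24b's `sliceR_mul_sliceS`;
`ι(U⁻¹)·exp(−zH)·exp(zH)·ι(U) = 1`). -/
theorem sliceS_mul_sliceR (ι : G →* Matrix o o ℂ) (U : GaugeField P 0 G) (H : PBond P 0 → Matrix o o ℂ) (z : ℂ) (b : PBond P 0) :
    sliceS ι U H z b * sliceR ι U H z b = 1 := by
  have hU : ι (U b)⁻¹ * ι (U b) = 1 := by rw [← map_mul, inv_mul_cancel, map_one]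
  calc sliceS ι U H z b * sliceR ι U H z b
      = ι (U b)⁻¹ * (NormedSpace.exp (-(z • H b)) * NormedSpace.exp (z • H b)) * ι (U b) := by simp only [sliceR, sliceS, mul_assoc]
    _ = 1 := by rw [SubstrateTransporterSpecies.exp_neg_mul_exp, mul_one, hU]

/-- [folklore] **THE TWO TOWERS OF THE SLICE ARE ENTRYWISE MUTUAL INVERSES** at every `z` whose iterated loop variables are `1∕3`-small at every
level `< K` (DISPLAYED — the depth disc discharges it on the unit disc after rescaling `H`; at `z = 0` it is `Small` + `ℰ.δ ≤ 1∕3`):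
§2 `iterRS_mul` from `sliceS_mul_sliceR` ∕ W-24b `sliceR_mul_sliceS`. -/
theorem towerSlice_snd_mul_fst (ι : G →* Matrix o o ℂ) (U : GaugeField P 0 G) (H : PBond P 0 → Matrix o o ℂ) (z : ℂ)
    (hsmall : ∀ j < P.K, ∀ c i, ‖loopHolRS (iterRS j (sliceR ι U H z, sliceS ι U H z)).1 (iterRS j (sliceR ι U H z, sliceS ι U H z)).2 c i - 1‖ ≤ 1 / 3)
    (k : Fin (P.K + 1)) (ν : Fin P.d) (i : Tor (fine (lev P.L k) (unitMod P)) × Fin P.d) :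
    (towerSlice P ι U H z).2 k ν i * (towerSlice P ι U H z).1 k ν i = 1 ∧ (towerSlice P ι U H z).1 k ν i * (towerSlice P ι U H z).2 k ν i = 1 := by
  obtain ⟨h1, h2⟩ := iterRS_mul (sliceS_mul_sliceR ι U H z) (sliceR_mul_sliceS ι U H z) (P.K - k) fun j hj => hsmall j (by omega)
  exact ⟨h1 _, h2 _⟩

/-- [folklore] **THE CHART READS THE TOWER BACK**: on the log window of the tower of record (DISPLAYED at `z`; automatic at `z = 0`),
`expChartT P (towerDataOf …) (towerCoord … z) = (towerSlice … z).1` (W-24a `expChartT_logChartT_of_unitary`). -/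
theorem expChartT_towerCoord (ℰ : LoopAverage G) (ι : G →* Matrix o o ℂ) (hι : ∀ g, ι g ∈ Matrix.unitaryGroup o ℂ) (U : GaugeField P 0 G)
    (H : PBond P 0 → Matrix o o ℂ) (z : ℂ)
    (hwin : ∀ (k : Fin (P.K + 1)) ν i, ‖(towerSlice P ι U H z).1 k ν i * (towerDataOf P ι (fun _ => blockAvg ℰ) U k ν i)⁻¹ - 1‖ < 1) :
    expChartT P (towerDataOf P ι (fun _ => blockAvg ℰ) U) (towerCoord P ℰ ι U H z) = (towerSlice P ι U H z).1 :=
  SubstrateExpChartLog.expChartT_logChartT_of_unitary P (fun k ν i => by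
    rw [towerDataOf, SubstrateBackgroundTransporters.transV_apply]; exact hι _) hwin

/-- [folklore] **… AND ITS INVERSE SIDE IS THE `S`-TOWER**: under the window and the `1∕3`-smallness at `z`,
`expChartInvT P (towerDataOf …) (towerCoord … z) = (towerSlice … z).2` — so the chart family `ComplexBackgroundFamily.ofChart (towerDataOf …) _ (towerCoord …)`
(W-22′ `FineFieldChart.family`) reads EXACTLY the two complex averaging towers of the slice (uniqueness of two-sided inverses). -/
theorem expChartInvT_towerCoord (ℰ : LoopAverage G) (ι : G →* Matrix o o ℂ) (hι : ∀ g, ι g ∈ Matrix.unitaryGroup o ℂ) (U : GaugeField P 0 G)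
    (H : PBond P 0 → Matrix o o ℂ) (z : ℂ)
    (hwin : ∀ (k : Fin (P.K + 1)) ν i, ‖(towerSlice P ι U H z).1 k ν i * (towerDataOf P ι (fun _ => blockAvg ℰ) U k ν i)⁻¹ - 1‖ < 1)
    (hsmall : ∀ j < P.K, ∀ c i, ‖loopHolRS (iterRS j (sliceR ι U H z, sliceS ι U H z)).1 (iterRS j (sliceR ι U H z, sliceS ι U H z)).2 c i - 1‖ ≤ 1 / 3) :
    expChartInvT P (towerDataOf P ι (fun _ => blockAvg ℰ) U) (towerCoord P ℰ ι U H z) = (towerSlice P ι U H z).2 := by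
  have hR : ∀ (k : Fin (P.K + 1)) ν i, IsUnit (towerDataOf P ι (fun _ => blockAvg ℰ) U k ν i).det := fun k ν i =>
    isUnit_det_of_mem_unitaryGroup (by rw [towerDataOf, SubstrateBackgroundTransporters.transV_apply]; exact hι _)
  have hexp := expChartT_towerCoord ℰ ι hι U H z hwin
  funext k ν i
  have h1 : expChartInvT P (towerDataOf P ι (fun _ => blockAvg ℰ) U) (towerCoord P ℰ ι U H z) k ν i * (towerSlice P ι U H z).1 k ν i = 1 := by
    rw [← hexp, SubstrateTransporterSpeciesHolo.expChartInvT_apply, SubstrateTransporterSpeciesHolo.expChartT_apply]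
    exact SubstrateTransporterSpecies.expChartInv_mul_expChart (hR k) _ ν i
  exact left_inv_eq_right_inv h1 (towerSlice_snd_mul_fst ι U H z hsmall k ν i).2

end Slice

/-! ### The `SU(n)` discharge of §4: every hypothesis PROVED but the field's levelwise smallness -/

section SliceSU

variable (P) {n : Type} [Fintype n] [DecidableEq n] [Nonempty n]

/-- [folklore] The radius of `expMeanLogSU` is at most `1∕3` (it is `min (1∕3) (π∕N)`). -/
theorem expMeanLogSU_δ_le_third : (expMeanLogSU (n := n)).δ ≤ 1 / 3 := by
  rw [ExpMeanLog.expMeanLogSU_δ]; exact min_le_left _ _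

/-- [folklore] **LETTER (1) FOR THE TOWER, `SU(n)`**: at `ℰ := expMeanLogSU`, `ι := fundamentalRep n`, for a fine `SU(n)` field small at
every level `< K`, the tower chart coordinate of its fine-field slice vanishes at `z = 0`. -/
theorem towerCoord_zero_SU (U : GaugeField P 0 (Matrix.specialUnitaryGroup n ℂ)) (H : PBond P 0 → Matrix n n ℂ)
    (hsmall : ∀ j < P.K, ∀ c, Small (expMeanLogSU (n := n)) (Averaging.iter (fun _ => blockAvg (expMeanLogSU (n := n))) j U) c) :
    towerCoord P (expMeanLogSU (n := n)) (fundamentalRep n) U H 0 = 0 :=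
  towerCoord_zero (expMeanLogSU (n := n)) expMeanLogSU_δ_le_third (fundamentalRep n) (fun g => fundamentalRep_mem_unitaryGroup g)
    (fun _ => rfl) (fun W hW => fundamentalRep_expMeanLogSU_E W hW) U H hsmall

/-- [folklore] **LETTER (2′) AT `z = 0` FOR THE TOWER, `SU(n)`**: … and it is holomorphic at `z = 0`. -/
theorem analyticAt_towerCoord_zero_SU (U : GaugeField P 0 (Matrix.specialUnitaryGroup n ℂ)) (H : PBond P 0 → Matrix n n ℂ)
    (hsmall : ∀ j < P.K, ∀ c, Small (expMeanLogSU (n := n)) (Averaging.iter (fun _ => blockAvg (expMeanLogSU (n := n))) j U) c) :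
    AnalyticAt ℂ (towerCoord P (expMeanLogSU (n := n)) (fundamentalRep n) U H) 0 :=
  analyticAt_towerCoord_zero (expMeanLogSU (n := n)) expMeanLogSU_δ_le_third (fundamentalRep n)
    (fun g => fundamentalRep_mem_unitaryGroup g) (fun _ => rfl) (fun W hW => fundamentalRep_expMeanLogSU_E W hW) U H hsmall

end SliceSU

end Summit.QuantumFields.BalabanUV.T4Continuum.SubstrateComplexAvgTower

end
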